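/-
Copyright (c) 2026 the pub-hodgecm-mathlib formalisation cell (harness21).  Prover seat hodgecm-mathlib-K2E4-p01 (g0), Track B ∕ K2-LIT (build stream 29),
h413 = `stmt-HodgeConjecture-24833`, line `K2_E4_SingularTransferKappaSign`, sockets #1 ∕ #7 at a SPLIT place: a smooth `Δ‴_v`-transfer pair reading the singular
point (`Φ^st((γ₀)_v, f) ≠ 0`, `f^H((γ_H)_v) ≠ 0`).  2026-09-03.
-/
import Summits.HodgeConjecture.HodgeConjecture.Theorems.K2E4ExplicitSplitSingularTransferDescent   -- ★ p854920: `exists_localStableOrbitalIntegral_eq_mul_cmSplitTransfer` (descent at `γ₀`)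
import Literature.NumberTheory.Rogawski1990.SingularLocalOrbitSeparation          -- ★ separating compact open `U`, `localStableOrbitalIntegral_indicator_ne_zero_of_sep`
import Literature.NumberTheory.Rogawski1990.AdelicStableOrbitalEulerDischargeSemisimple  -- ★ `mul_sub_smul_toLocal_toAdelic_eq_zero`, `isUnit_algebraMap_localRing_sub`
import Literature.NumberTheory.GaloisRepresentations.HeckeCharacterConjugateDualOfQuadraticCM  -- ★ `galConj_eq_inv_of_restrict_eq_quadraticHeckeCharCM` (`hdual` from `hμω`)
import Literature.NumberTheory.Automorphic.QuadraticHeckeCharacterCM              -- ★ `quadraticHeckeCharCM` (the μ-guard of the letters)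
import Literature.MeasureTheory.Group.RightInvariantIsHaar                            -- ★ `isHaarMeasure_of_isMulRightInvariant_of_ne_zero` (appended §4)
import Literature.NumberTheory.Automorphic.LocalOrbitalMeasureRegular                -- ★ `isMulRightInvariant_localEndoscopic` (`H_v` unimodular; appended §4)
import HarnessLib

/-!
# h413 ∕ Track B «K2-LIT», line `K2_E4_SingularTransferKappaSign` — at a SPLIT place, a smooth `Δ‴_v`-transfer pair `(f^H, f)` with `Φ^st_{|ω|}((γ₀)_v, f) ≠ 0` and
# `f^H((γ_H)_v) ≠ 0` (helper, `--supports`; the split half of the witness socket #7 for PINNED data, and the non-vanishing companion of #1)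

Cell `pub/hodgecm-mathlib`, crux H413 = `stmt-HodgeConjecture-24833`, route `HCCMUnconditional`; chair K2-lead (g0), dealer K2E4-plan (g0); seat K2E4-p01 (file #1 ∕ pool X1b′).
THEOREMS ONLY (no `def`, no `instance`, no `notation`, no named-fact hypothesis, no `sorry`, default heartbeats); count-neutral.
WHAT.  `exists_transferPair_apply_scalarPartner_ne_zero`: for `H′` hermitian anisotropic, `w ∣ v` with `c • w ≠ w`, Haar measures `νH` on `H_v`, `νG` on `G′_v`, families `mH`,
`mG` CANONICAL for them on the (`G`-)regular classes (the letters' `hCTM` clauses), `μ` with `μ|_{𝕀_{L⁺}} = ω_{L∕L⁺}` (the letters' `hμω`), an ★ `IsQuotientOf` family `m` of `νG`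
on a class predicate met by `⟦(γ₀)_v⟧` (the letters' |ω|_v-Tamagawa `mGs₀_v`), print's semiregular `γ₀` and its scalar partner `γ_H = (e₁·1₂, e₂)`: there are `f ∈ C_c^∞(G′_v)`
and `f^H ∈ C_c^∞(H_v)` with `f → f^H` for `Δ‴_v = finExplicitCollection … v` (★ `IsLocalDeltaTransfer`), `Φ^st((γ₀)_v, f; m) ≠ 0` and `f^H((γ_H)_v) ≠ 0`.
HOW.  `f = 1_U` for a compact open `U ∋ (γ₀)_v` meeting `𝒪_st((γ₀)_v)` only in the class of `(γ₀)_v` (★ `exists_isCompact_isOpen_forall_isStablyConj_imp_isConj`), so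
`Φ^st((γ₀)_v, 1_U) ≠ 0` (★ `localStableOrbitalIntegral_indicator_ne_zero_of_sep`, the member of `m` at the class being non-zero, invariant, Radon: ★ `IsQuotientOf.isAdmissibleOn`);
`f^H = τ_v · f̄^P` (★ `cmSplitTransfer`) is smooth and a `Δ‴_v`-transfer (★ `isLocalDeltaTransfer_cmSplitTransfer`, [Rogawski1990, Lemma 4.13.1 (a)] BY NAME); its prefactor
`νG(K′)∕νH(K_H)` is non-zero (`K′ = e′⁻¹GL₃(𝒪_w)`, `K_H` compact open: `h ↦ diag(e₂ h.1, e₁ h.2)` is a closed embedding, ★ `exists_continuousMulEquiv_prod_standardLeviGL_twoBlock`);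
and ★ p854920 `exists_localStableOrbitalIntegral_eq_mul_cmSplitTransfer` gives `Φ^st((γ₀)_v, f) = c · f^H((γ_H)_v)` with `c ≠ 0`.
HONEST LABEL.  HC_CM is proved only modulo the 7 printed citations (2 remaining named inputs: hLiu418 = `stmt-HodgeConjecture-24832`, h413 = `stmt-HodgeConjecture-24833`) until
rung 0 closes; this file moves no counter (the ∀-transfer form #1 still needs the germ-kernel socket #5 — Harish-Chandra density at the `H`-centre — OWNER K2E3).

## References
* [Rogawski1990] J. D. Rogawski, *Automorphic Representations of Unitary Groups in Three Variables*, Ann. of Math. Stud. 123 (1990): §8.2 Prop. 8.2.1 (a) p. 117; §4.13 Lemma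
  4.13.1 (a) pp. 64–66, p. 70; §4.9 Prop. 4.9.1 (a) p. 55; §4.1 (4.1.1) p. 39.
* [GetzHahn2024] J. R. Getz, H. Hahn, *An Introduction to Automorphic Representations*, GTM 300 (2024), §17.3 (closed orbits, separation).
-/

set_option autoImplicit false
set_option linter.dupNamespace false

noncomputable section

open MeasureTheory Measure NumberField IsDedekindDomain TopologicalSpace Topology
open Literature.MeasureTheory.Group
open Literature.NumberTheory.Rogawski1990 Literature.NumberTheory.Automorphic Literature.NumberTheory.Automorphic.UnitaryGroup
open Literature.NumberTheory.GaloisRepresentations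
open Literature.AlgebraicGeometry.ShimuraVarieties (unitaryGroup)
open scoped Matrix MatrixGroups NNReal ENNReal

namespace Summit.HodgeConjecture.HodgeConjecture.Cruxes.H413.K2E4ExplicitSplitSingularTransferDescent

/-! ## §3 A smooth `Δ‴_v`-transfer pair reading the singular point: `f = 1_U` separating, `f^H = τ_v · f̄^P` -/

section Witness

variable (L : Type) [Field L] [NumberField L] [IsCMField L] (H' : Matrix (Fin 3) (Fin 3) L) (v : HeightOneSpectrum (𝓞 ↥(maximalRealSubfield L)))
  [iG : MeasurableSpace ((UnitaryGroup.cmDatum L 3 H').Local v)] [bG : BorelSpace ((UnitaryGroup.cmDatum L 3 H').Local v)]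
  [iQ : ∀ γ : (UnitaryGroup.cmDatum L 3 H').Local v, MeasurableSpace ((UnitaryGroup.cmDatum L 3 H').Local v ⧸ Subgroup.centralizer ({γ} : Set ((UnitaryGroup.cmDatum L 3 H').Local v)))]
  [bQ : ∀ γ : (UnitaryGroup.cmDatum L 3 H').Local v, BorelSpace ((UnitaryGroup.cmDatum L 3 H').Local v ⧸ Subgroup.centralizer ({γ} : Set ((UnitaryGroup.cmDatum L 3 H').Local v)))]
  [iH : MeasurableSpace ((UnitaryGroup.cmDatum L 2 (Matrix.of fun i j : Fin 2 => if i.val + j.val + 1 = 2 then (1 : L) else 0)).Local v × (UnitaryGroup.cmDatum L 1 (Matrix.of fun i j : Fin 1 => if i.val + j.val + 1 = 1 then (1 : L) else 0)).Local v)] [bH : BorelSpace ((UnitaryGroup.cmDatum L 2 (Matrix.of fun i j : Fin 2 => if i.val + j.val + 1 = 2 then (1 : L) else 0)).Local v × (UnitaryGroup.cmDatum L 1 (Matrix.of fun i j : Fin 1 => if i.val + j.val + 1 = 1 then (1 : L) else 0)).Local v)]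
  [iQH : ∀ a : (UnitaryGroup.cmDatum L 2 (Matrix.of fun i j : Fin 2 => if i.val + j.val + 1 = 2 then (1 : L) else 0)).Local v × (UnitaryGroup.cmDatum L 1 (Matrix.of fun i j : Fin 1 => if i.val + j.val + 1 = 1 then (1 : L) else 0)).Local v, MeasurableSpace (((UnitaryGroup.cmDatum L 2 (Matrix.of fun i j : Fin 2 => if i.val + j.val + 1 = 2 then (1 : L) else 0)).Local v × (UnitaryGroup.cmDatum L 1 (Matrix.of fun i j : Fin 1 => if i.val + j.val + 1 = 1 then (1 : L) else 0)).Local v) ⧸ Subgroup.centralizer ({a} : Set ((UnitaryGroup.cmDatum L 2 (Matrix.of fun i j : Fin 2 => if i.val + j.val + 1 = 2 then (1 : L) else 0)).Local v × (UnitaryGroup.cmDatum L 1 (Matrix.of fun i j : Fin 1 => if i.val + j.val + 1 = 1 then (1 : L) else 0)).Local v)))]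
  [bQH : ∀ a : (UnitaryGroup.cmDatum L 2 (Matrix.of fun i j : Fin 2 => if i.val + j.val + 1 = 2 then (1 : L) else 0)).Local v × (UnitaryGroup.cmDatum L 1 (Matrix.of fun i j : Fin 1 => if i.val + j.val + 1 = 1 then (1 : L) else 0)).Local v, BorelSpace (((UnitaryGroup.cmDatum L 2 (Matrix.of fun i j : Fin 2 => if i.val + j.val + 1 = 2 then (1 : L) else 0)).Local v × (UnitaryGroup.cmDatum L 1 (Matrix.of fun i j : Fin 1 => if i.val + j.val + 1 = 1 then (1 : L) else 0)).Local v) ⧸ Subgroup.centralizer ({a} : Set ((UnitaryGroup.cmDatum L 2 (Matrix.of fun i j : Fin 2 => if i.val + j.val + 1 = 2 then (1 : L) else 0)).Local v × (UnitaryGroup.cmDatum L 1 (Matrix.of fun i j : Fin 1 => if i.val + j.val + 1 = 1 then (1 : L) else 0)).Local v)))]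

/-- **A TRANSFER PAIR THAT SEES THE SINGULAR POINT (split `v`).**  Under the hypotheses of §2 with CANONICAL families `mH`, `mG` for Haar measures `νH`, `νG` and the
PINNED explicit factor `Δ‴_v` (`μ` with `μ|_{𝕀_{L⁺}} = ω_{L∕L⁺}`): there is a smooth `Δ‴_v`-transfer pair `(f^H, f)` with `Φ^st((γ₀)_v, f; m) ≠ 0` AND `f^H((γ_H)_v) ≠ 0` —
`f = 1_U` for a compact open `U ∋ (γ₀)_v` meeting `𝒪_st((γ₀)_v)` only in the class of `(γ₀)_v` (★ `exists_isCompact_isOpen_forall_isStablyConj_imp_isConj`, ★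
`localStableOrbitalIntegral_indicator_ne_zero_of_sep`), `f^H = τ_v · f̄^P` (★ `cmSplitTransfer`, a transfer by ★ `isLocalDeltaTransfer_cmSplitTransfer`), and §2.  This is the
split-place half of the witness socket `sig_K2E3GermConstantRegularH` (#7) for pinned data. [cite: Rogawski1990, §8.2 Prop. 8.2.1 (a) p. 117; §4.13 Lemma 4.13.1 (a) p. 70;
§4.9 Prop. 4.9.1 (a) p. 55] -/
theorem exists_transferPair_apply_scalarPartner_ne_zero (w : UnitaryGroup.PlacesOver L v) (hw : IsCMField.complexConj L • w.1 ≠ w.1)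
    (hherm : (H'.map (cmConjRingHom L)).transpose = H')
    (hanis : ∀ x : Fin 3 → L, Literature.AlgebraicGeometry.ShimuraVarieties.hermForm (cmConjRingHom L) H' x x = 0 → x = 0) (hH'd : IsUnit H'.det)
    (νG : Measure ((UnitaryGroup.cmDatum L 3 H').Local v)) [νG.IsHaarMeasure] [νG.IsMulRightInvariant]
    (νH : Measure ((UnitaryGroup.cmDatum L 2 (Matrix.of fun i j : Fin 2 => if i.val + j.val + 1 = 2 then (1 : L) else 0)).Local v × (UnitaryGroup.cmDatum L 1 (Matrix.of fun i j : Fin 1 => if i.val + j.val + 1 = 1 then (1 : L) else 0)).Local v)) [νH.IsHaarMeasure] [νH.IsMulRightInvariant]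
    (mH : OrbitalMeasureFamily ((UnitaryGroup.cmDatum L 2 (Matrix.of fun i j : Fin 2 => if i.val + j.val + 1 = 2 then (1 : L) else 0)).Local v × (UnitaryGroup.cmDatum L 1 (Matrix.of fun i j : Fin 1 => if i.val + j.val + 1 = 1 then (1 : L) else 0)).Local v)) (mG : OrbitalMeasureFamily ((UnitaryGroup.cmDatum L 3 H').Local v))
    (hcanH : mH.IsCanonical (IsLocalGRegular L v) νH)
    (hcanG : mG.IsCanonical (fun γ : (UnitaryGroup.cmDatum L 3 H').Local v => IsRegularElt (γ.val : GL (Fin 3) (UnitaryGroup.LocalRing L v))) νG)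
    (μ : HeckeCharacter L)
    (hμω : ∀ x : Literature.NumberTheory.GaloisRepresentations.ideleGroup ↥(maximalRealSubfield L),
      μ (AdeleRing.ideleBaseChange (↥(maximalRealSubfield L)) L x) = quadraticHeckeCharCM L x)
    {P : (UnitaryGroup.cmDatum L 3 H').Local v → Prop} {tZ : ∀ γ : (UnitaryGroup.cmDatum L 3 H').Local v, Measure (Subgroup.centralizer ({γ} : Set ((UnitaryGroup.cmDatum L 3 H').Local v)))}
    {m : OrbitalMeasureFamily ((UnitaryGroup.cmDatum L 3 H').Local v)} (hm : m.IsQuotientOf P νG tZ)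
    (γ₀ : (UnitaryGroup.cmDatum L 3 H').Rational) {e₁ e₂ : L} (hne : e₁ ≠ e₂)
    (hprod : ((((γ₀ : unitaryGroup (cmConjRingHom L) H').val : GL (Fin 3) L) : Matrix (Fin 3) (Fin 3) L) - e₁ • (1 : Matrix (Fin 3) (Fin 3) L)) * ((((γ₀ : unitaryGroup (cmConjRingHom L) H').val : GL (Fin 3) L) : Matrix (Fin 3) (Fin 3) L) - e₂ • (1 : Matrix (Fin 3) (Fin 3) L)) = 0)
    (hnsc : ¬ ∃ ζ : L, (((γ₀ : unitaryGroup (cmConjRingHom L) H').val : GL (Fin 3) L) : Matrix (Fin 3) (Fin 3) L) = ζ • (1 : Matrix (Fin 3) (Fin 3) L))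
    (hchar : (((γ₀ : unitaryGroup (cmConjRingHom L) H').val : GL (Fin 3) L) : Matrix (Fin 3) (Fin 3) L).charpoly = (Polynomial.X - Polynomial.C e₁) ^ 2 * (Polynomial.X - Polynomial.C e₂))
    (hP : P (Quotient.out (ConjClasses.mk ((UnitaryGroup.cmDatum L 3 H').toLocal v ((UnitaryGroup.cmDatum L 3 H').toAdelic γ₀)))))
    (γH : (UnitaryGroup.cmDatum L 2 (Matrix.of fun i j : Fin 2 => if i.val + j.val + 1 = 2 then (1 : L) else 0)).Rational × (UnitaryGroup.cmDatum L 1 (Matrix.of fun i j : Fin 1 => if i.val + j.val + 1 = 1 then (1 : L) else 0)).Rational)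
    (hγH1 : (((γH.1 : unitaryGroup (cmConjRingHom L) (Matrix.of fun i j : Fin 2 => if i.val + j.val + 1 = 2 then (1 : L) else 0)).val : GL (Fin 2) L) : Matrix (Fin 2) (Fin 2) L) = e₁ • (1 : Matrix (Fin 2) (Fin 2) L))
    (hγH2 : (((γH.2 : unitaryGroup (cmConjRingHom L) (Matrix.of fun i j : Fin 1 => if i.val + j.val + 1 = 1 then (1 : L) else 0)).val : GL (Fin 1) L) : Matrix (Fin 1) (Fin 1) L) 0 0 = e₂) :
    ∃ (fH : (UnitaryGroup.cmDatum L 2 (Matrix.of fun i j : Fin 2 => if i.val + j.val + 1 = 2 then (1 : L) else 0)).Local v × (UnitaryGroup.cmDatum L 1 (Matrix.of fun i j : Fin 1 => if i.val + j.val + 1 = 1 then (1 : L) else 0)).Local v → ℂ) (f : (UnitaryGroup.cmDatum L 3 H').Local v → ℂ),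
      IsLocSmooth f ∧ IsLocSmooth fH ∧
        IsLocalDeltaTransfer L H' v ((finExplicitCollection L H' μ (finExplicitDelta_conj_left_all L H' μ) (finExplicitDelta_conj_right_all L H' μ)) v) mH mG fH f ∧
        localStableOrbitalIntegral L 3 H' v m f ((UnitaryGroup.cmDatum L 3 H').toLocal v ((UnitaryGroup.cmDatum L 3 H').toAdelic γ₀)) ≠ 0 ∧
        fH ((UnitaryGroup.cmDatum L 2 (Matrix.of fun i j : Fin 2 => if i.val + j.val + 1 = 2 then (1 : L) else 0)).toLocal v ((UnitaryGroup.cmDatum L 2 (Matrix.of fun i j : Fin 2 => if i.val + j.val + 1 = 2 then (1 : L) else 0)).toAdelic γH.1), (UnitaryGroup.cmDatum L 1 (Matrix.of fun i j : Fin 1 => if i.val + j.val + 1 = 1 then (1 : L) else 0)).toLocal v ((UnitaryGroup.cmDatum L 1 (Matrix.of fun i j : Fin 1 => if i.val + j.val + 1 = 1 then (1 : L) else 0)).toAdelic γH.2)) ≠ 0 := by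
  have hdet : H'.det ≠ 0 := hH'd.ne_zero
  set γv : (UnitaryGroup.cmDatum L 3 H').Local v := (UnitaryGroup.cmDatum L 3 H').toLocal v ((UnitaryGroup.cmDatum L 3 H').toAdelic γ₀) with hγv
  -- (1) the separating indicator `f = 1_U`
  have hab : IsUnit (algebraMap L (UnitaryGroup.LocalRing L v) e₁ - algebraMap L (UnitaryGroup.LocalRing L v) e₂) := isUnit_algebraMap_localRing_sub v hne
  have hγab := mul_sub_smul_toLocal_toAdelic_eq_zero v γ₀ hprod
  obtain ⟨U, hUc, hUo, hγU, hU⟩ := exists_isCompact_isOpen_forall_isStablyConj_imp_isConj L 3 H' v hherm hdet γv hab hγab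
  have hf : IsLocSmooth (U.indicator fun _ => (1 : ℂ)) := isLocSmooth_indicator hUo hUc.isClosed hUc
  have hadm := hm.isAdmissibleOn (ConjClasses.mk γv) hP
  have hΦ : localStableOrbitalIntegral L 3 H' v m (U.indicator fun _ => (1 : ℂ)) γv ≠ 0 :=
    localStableOrbitalIntegral_indicator_ne_zero_of_sep L 3 H' v hherm hdet hab hγab hUo hUc hγU hU m hadm.1 hadm.2.1 hadm.2.2 γv (IsStablyConj.refl _)
  -- (2) `f^H = τ_v · f̄^P` is a smooth `Δ‴_v`-transfer (★ B5 by name)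
  letI : MeasurableSpace (w.1.adicCompletion L) := borel _
  haveI : BorelSpace (w.1.adicCompletion L) := ⟨rfl⟩
  have hΦ₂d : (Matrix.of fun i j : Fin 2 => if i.val + j.val + 1 = 2 then (1 : L) else 0).det ≠ 0 := by
    have h : (Matrix.of fun i j : Fin 2 => if i.val + j.val + 1 = 2 then (1 : L) else 0) = !![0, 1; 1, 0] := by
      ext i j; fin_cases i <;> fin_cases j <;> rfl
    rw [h, Matrix.det_fin_two_of]; norm_num
  have hΦ₁d : (Matrix.of fun i j : Fin 1 => if i.val + j.val + 1 = 1 then (1 : L) else 0).det ≠ 0 := by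
    rw [Matrix.det_fin_one, Matrix.of_apply]; norm_num
  have hΦ₂' : ((Matrix.of fun i j : Fin 2 => if i.val + j.val + 1 = 2 then (1 : L) else 0).map (cmConjRingHom L))ᵀ =
      Matrix.of fun i j : Fin 2 => if i.val + j.val + 1 = 2 then (1 : L) else 0 := by
    rw [UnitaryGroup.map_cmConjRingHom_eq_map_complexConj]; exact UnitaryGroup.antidiagOne_map_transpose (IsCMField.complexConj L) 2
  have hΦ₁' : ((Matrix.of fun i j : Fin 1 => if i.val + j.val + 1 = 1 then (1 : L) else 0).map (cmConjRingHom L))ᵀ =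
      Matrix.of fun i j : Fin 1 => if i.val + j.val + 1 = 1 then (1 : L) else 0 := by
    rw [UnitaryGroup.map_cmConjRingHom_eq_map_complexConj]; exact UnitaryGroup.antidiagOne_map_transpose (IsCMField.complexConj L) 1
  have hT := @isLocalDeltaTransfer_cmSplitTransfer L _ _ _ H' v (IsCMField.complexConj_ne_one L) w hw
    (UnitaryGroup.antidiagOne_map_transpose (IsCMField.complexConj L) 2) (UnitaryGroup.isUnit_placeForm_antidiagOne (E := L) 2 w.1)
    (UnitaryGroup.antidiagOne_map_transpose (IsCMField.complexConj L) 1) (UnitaryGroup.isUnit_placeForm_antidiagOne (E := L) 1 w.1)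
    ((UnitaryGroup.map_cmConjRingHom_eq_map_complexConj L H') ▸ hherm) (UnitaryGroup.isUnit_placeForm_of_isUnit_det hH'd w.1)
    hΦ₂' hΦ₂d hΦ₁' hΦ₁d _ _ iH bH iG bG iQH bQH iQ bQ μ (finExplicitDelta_conj_left_all L H' μ) (finExplicitDelta_conj_right_all L H' μ)
    (HeckeCharacter.galConj_eq_inv_of_restrict_eq_quadraticHeckeCharCM L μ hμω) νH _ _ νG _ _ mH mG hcanH hcanG hherm hH'd _ hf
  -- (3) the prefactor `νG(K′)∕νH(K_H)` of `cmSplitTransfer` is non-zero (`K′`, `K_H` compact open)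
  obtain ⟨e', he'⟩ : ∃ e' : (UnitaryGroup.cmDatum L 3 H').Local v ≃ₜ* GL (Fin 3) (w.1.adicCompletion L),
      e' = localSplitEquiv (IsCMField.complexConj L) H' (IsCMField.complexConj_ne_one L)
        ((UnitaryGroup.map_cmConjRingHom_eq_map_complexConj L H') ▸ hherm) w hw (UnitaryGroup.isUnit_placeForm_of_isUnit_det hH'd w.1) := ⟨_, rfl⟩
  have hK'set : ((cmSplitMaxCompact L v w hw H' hherm hH'd : Subgroup _) : Set ((UnitaryGroup.cmDatum L 3 H').Local v)) =
      e' ⁻¹' (glInt 3 (w.1.adicCompletion L) : Set (GL (Fin 3) (w.1.adicCompletion L))) := by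
    ext g; rw [he']; exact UnitaryGroup.mem_cmSplitMaxCompact_iff L v w hw H' hherm hH'd g
  have hK'0 : νG (cmSplitMaxCompact L v w hw H' hherm hH'd) ≠ 0 := by
    have hopen : IsOpen ((cmSplitMaxCompact L v w hw H' hherm hH'd : Subgroup _) : Set ((UnitaryGroup.cmDatum L 3 H').Local v)) := by
      rw [hK'set]; exact (isOpen_glInt (n := 3) (F := w.1.adicCompletion L)).preimage e'.continuous
    exact (hopen.measure_pos νG ⟨1, (cmSplitMaxCompact L v w hw H' hherm hH'd).one_mem⟩).ne'
  have hK't : νG (cmSplitMaxCompact L v w hw H' hherm hH'd) ≠ ⊤ := by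
    have hcpt : IsCompact ((cmSplitMaxCompact L v w hw H' hherm hH'd : Subgroup _) : Set ((UnitaryGroup.cmDatum L 3 H').Local v)) := by
      rw [hK'set]; exact e'.toHomeomorph.isCompact_preimage.2 (isCompact_glInt (n := 3) (F := w.1.adicCompletion L))
    exact hcpt.measure_lt_top.ne
  have hψ : IsClosedEmbedding (cmSplitLeviGL L v w hw) := by
    haveI := (IsNonarchimedeanLocalField.isLocalField (w.1.adicCompletion L)).toT2Space
    obtain ⟨E0, hE0⟩ := exists_continuousMulEquiv_prod_standardLeviGL_twoBlock (S := w.1.adicCompletion L) (k := 2) (l := 1)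
    have hφ : IsClosedEmbedding (fun x : GL (Fin 2) (w.1.adicCompletion L) × GL (Fin 1) (w.1.adicCompletion L) =>
        UnitaryGroup.reindexGL finSumFinEquiv (UnitaryGroup.blockDiagGL x)) := by
      have h1 : (fun x : GL (Fin 2) (w.1.adicCompletion L) × GL (Fin 1) (w.1.adicCompletion L) =>
          UnitaryGroup.reindexGL finSumFinEquiv (UnitaryGroup.blockDiagGL x)) = Subtype.val ∘ E0 := funext fun x => (hE0 x).symm
      rw [h1]
      exact (IsClosed.isClosedEmbedding_subtypeVal (isClosed_standardLeviGL _)).comp E0.toHomeomorph.isClosedEmbedding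
    have h2 : (cmSplitLeviGL L v w hw : _ → GL (Fin 3) (w.1.adicCompletion L)) =
        (fun x : GL (Fin 2) (w.1.adicCompletion L) × GL (Fin 1) (w.1.adicCompletion L) => UnitaryGroup.reindexGL finSumFinEquiv (UnitaryGroup.blockDiagGL x)) ∘
          (fun h => (cmSplitEquivTwo L v w hw h.1, cmSplitEquivOne L v w hw h.2)) := rfl
    rw [h2]
    exact hφ.comp ((cmSplitEquivTwo L v w hw).toHomeomorph.prodCongr (cmSplitEquivOne L v w hw).toHomeomorph).isClosedEmbedding
  have hKHset : ((cmSplitLeviCompact L v w hw : Subgroup _) : Set ((UnitaryGroup.cmDatum L 2 (Matrix.of fun i j : Fin 2 => if i.val + j.val + 1 = 2 then (1 : L) else 0)).Local v × (UnitaryGroup.cmDatum L 1 (Matrix.of fun i j : Fin 1 => if i.val + j.val + 1 = 1 then (1 : L) else 0)).Local v)) =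
      (cmSplitLeviGL L v w hw) ⁻¹' (glInt 3 (w.1.adicCompletion L) : Set (GL (Fin 3) (w.1.adicCompletion L))) := by
    ext h; exact UnitaryGroup.mem_cmSplitLeviCompact_iff L v w hw h
  have hKH0 : νH (cmSplitLeviCompact L v w hw) ≠ 0 := by
    have hopen : IsOpen ((cmSplitLeviCompact L v w hw : Subgroup _) : Set ((UnitaryGroup.cmDatum L 2 (Matrix.of fun i j : Fin 2 => if i.val + j.val + 1 = 2 then (1 : L) else 0)).Local v × (UnitaryGroup.cmDatum L 1 (Matrix.of fun i j : Fin 1 => if i.val + j.val + 1 = 1 then (1 : L) else 0)).Local v)) := by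
      rw [hKHset]; exact (isOpen_glInt (n := 3) (F := w.1.adicCompletion L)).preimage hψ.continuous
    exact (hopen.measure_pos νH ⟨1, (cmSplitLeviCompact L v w hw).one_mem⟩).ne'
  have hKHt : νH (cmSplitLeviCompact L v w hw) ≠ ⊤ := by
    have hcpt : IsCompact ((cmSplitLeviCompact L v w hw : Subgroup _) : Set ((UnitaryGroup.cmDatum L 2 (Matrix.of fun i j : Fin 2 => if i.val + j.val + 1 = 2 then (1 : L) else 0)).Local v × (UnitaryGroup.cmDatum L 1 (Matrix.of fun i j : Fin 1 => if i.val + j.val + 1 = 1 then (1 : L) else 0)).Local v)) := by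
      rw [hKHset]; exact hψ.isCompact_preimage (isCompact_glInt (n := 3) (F := w.1.adicCompletion L))
    exact hcpt.measure_lt_top.ne
  have hr : ((νG (cmSplitMaxCompact L v w hw H' hherm hH'd)).toReal / (νH (cmSplitLeviCompact L v w hw)).toReal : ℝ) ≠ 0 :=
    div_ne_zero (ENNReal.toReal_ne_zero.2 ⟨hK'0, hK't⟩) (ENNReal.toReal_ne_zero.2 ⟨hKH0, hKHt⟩)
  -- (4) §2 at `f = 1_U`
  obtain ⟨c, hc, hcf⟩ := exists_localStableOrbitalIntegral_eq_mul_cmSplitTransfer L H' v w hw hherm hanis hH'd νG νH hr μ hm γ₀ hne hprod hnsc hchar hP γH hγH1 hγH2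
  refine ⟨cmSplitTransfer L H' hherm hH'd v w hw μ νH νG (U.indicator fun _ => (1 : ℂ)), U.indicator fun _ => (1 : ℂ), hf, hT.1, hT.2, hΦ, ?_⟩
  intro h0
  apply hΦ
  rw [hcf _ hf, h0, mul_zero]

end Witness

/-! ## §4 (appended) The letters' `νH_v` is a Haar measure as soon as it is non-zero -/

section HaarOfNeZero

variable (L : Type) [Field L] [NumberField L] [IsCMField L] (v : HeightOneSpectrum (𝓞 ↥(maximalRealSubfield L)))
  [MeasurableSpace ((UnitaryGroup.cmDatum L 2 (Matrix.of fun i j : Fin 2 => if i.val + j.val + 1 = 2 then (1 : L) else 0)).Local v × (UnitaryGroup.cmDatum L 1 (Matrix.of fun i j : Fin 1 => if i.val + j.val + 1 = 1 then (1 : L) else 0)).Local v)] [BorelSpace ((UnitaryGroup.cmDatum L 2 (Matrix.of fun i j : Fin 2 => if i.val + j.val + 1 = 2 then (1 : L) else 0)).Local v × (UnitaryGroup.cmDatum L 1 (Matrix.of fun i j : Fin 1 => if i.val + j.val + 1 = 1 then (1 : L) else 0)).Local v)]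

/-- **The letters' `νH_v` (bound only as a right-invariant Radon measure on `H_v = U(Φ₂)(L⁺_v) × U(Φ₁)(L⁺_v)`) IS A HAAR MEASURE once it is non-zero** — `H_v` is
unimodular (★ `isMulRightInvariant_localEndoscopic`), so ★ `isHaarMeasure_of_isMulRightInvariant_of_ne_zero` applies with `νi = haar`.  This is the glue between the frame
of the sockets (`[IsFiniteMeasureOnCompacts (νH v)] [(νH v).IsMulRightInvariant]`) and §3 ∕ ★ `isLocalDeltaTransfer_cmSplitTransfer` (`[νH.IsHaarMeasure]`); non-vanishing of
`νH v` follows in the letters' frame from `hCTM` (the family `mH v` is canonical for `νH v` AND admissible, i.e. non-zero, on the `G`-regular classes).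
[cite: Rogawski1990, §1.7 p. 6; §4.9 p. 54] [cite: Folland1999, Thm 11.9] -/
theorem isHaarMeasure_localEndoscopic_of_ne_zero (νH : Measure ((UnitaryGroup.cmDatum L 2 (Matrix.of fun i j : Fin 2 => if i.val + j.val + 1 = 2 then (1 : L) else 0)).Local v × (UnitaryGroup.cmDatum L 1 (Matrix.of fun i j : Fin 1 => if i.val + j.val + 1 = 1 then (1 : L) else 0)).Local v)) [IsFiniteMeasureOnCompacts νH] [νH.IsMulRightInvariant]
    (hνH : νH ≠ 0) : νH.IsHaarMeasure := by
  haveI : (Measure.haar : Measure ((UnitaryGroup.cmDatum L 2 (Matrix.of fun i j : Fin 2 => if i.val + j.val + 1 = 2 then (1 : L) else 0)).Local v × (UnitaryGroup.cmDatum L 1 (Matrix.of fun i j : Fin 1 => if i.val + j.val + 1 = 1 then (1 : L) else 0)).Local v)).IsMulRightInvariant := isMulRightInvariant_localEndoscopic L v Measure.haar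
  exact isHaarMeasure_of_isMulRightInvariant_of_ne_zero Measure.haar νH hνH

end HaarOfNeZero

end Summit.HodgeConjecture.HodgeConjecture.Cruxes.H413.K2E4ExplicitSplitSingularTransferDescent

end
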